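import Summits.HodgeConjecture.HodgeConjecture.Theorems.K2E1bUnitaryDualOfParts   -- ★ Q12 p857054: `ModelOfRecordStmt`, `RecordIrreducibleStmt`, `DatumUnitaryDualStmt`, `UnitarityDescendsStmt`, `unitaryDualWith_of_parts`
import HarnessLib

/-!
# K2 ∕ E1b unit U8d — GLUE Q13 «socket 8b from its parts, COH-UNITARY model of record» (`UnitaryDualWith dsCarriersOfRecord P` from 8b-αᵤ ∕ 8b-α′ ∕ 8b-β ∕ 8b-δ)

Cell hodgecm-mathlib, Track B «K2-LIT», engine E1b, unit U8d «Clozel–Delorme pseudo-coefficients with χ-support» (LEVEL B′, K2-lead R17);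
crux item h413 = stmt-HodgeConjecture-24833 (supports-only helper; closes nothing by itself).  Author K2E1b-plan (g4), 2026-09-04, acting on
the 8b-α CENSUS of K2-defs1 (g3) (`K2/K2-defs1/g3/CENSUS-8b-alpha-ModelOfRecord.K2-defs1-g3.md`, recommendation R1).

WHY.  The ★ Q12 glue `unitaryDualWith_of_parts` (p857054) calls its named input 8b-α `ModelOfRecordStmt` («every ADMISSIBLE irreducible
`(𝔤,K)`-module of `U(2,1)` with χ-scalars `(κ,e)` is the record of a Kovačević datum at `e`») only AFTER unpacking ★ `IsChiPinnedCohUnitary`, i.e.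
on a representative `r` with `IsCohUnitaryIrrep r.ρK r.ρ𝔤` in hand.  As typed, 8b-α silently contains «`K`-multiplicity one for EVERY irreducible
admissible `(𝔤,K)`-module of `U(2,1)`» (Kraljević; assumed in Kovacevic2021 §3) — not in the tree; for COH-UNITARY modules multiplicity `≤ 1` is
★ (Gelfand's trick: ★ `isAdmissibleGK_of_irreducible_unitary_uFormGroup_two_one` via ★ `commute_orbitalOp_uFormGroup_two_one` + ★
`exists_forall_homSpace_eq_smul_of_commute_orbitalOp`, reached through ★ `isInfUnitary_of_isInfUnitaryAlongP` + ★
`hasUnitaryGlobalization_of_isInfUnitary_uTwoOne`).  So the live cone should run through the WEAKER named input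

* `ModelOfRecordCohUnitaryStmt` (8b-αᵤ, L–XL, 0 new named inputs): every COH-UNITARY irreducible `(𝔤,K)`-module `r` of `U(2,1)`
  (★ `IsCohUnitaryIrrep`: `(𝔤,K)`-module, irreducible, admissible, unitary along `𝔭 ⊕ ℝz₀`) with χ-scalars `(κ, e)` is `(𝔤,K)`-equivalent to the
  structure of record `(ρKOfRecord 𝒟 e, σOfRecord 𝒟 e)` (★ #23) of a Kovačević datum `𝒟` at the central weight `e`.

THIS FILE (kernel-checked, 0 sorry): the def (DEFS BEFORE SIGS), the arrow `modelOfRecordCohUnitary_of_modelOfRecord : ModelOfRecordStmt →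
ModelOfRecordCohUnitaryStmt` (so 8b-αᵤ is weaker than 8b-α by a checked implication, and a payer of 8b-α still pays 8b-αᵤ), and the glue
`unitaryDualWith_of_parts_cohUnitary P hP hαᵤ hα' hβ hδ : UnitaryDualWith dsCarriersOfRecord P` — the proof of ★ `unitaryDualWith_of_parts` with
the one call of 8b-α replaced (the representative's `IsCohUnitaryIrrep` is passed whole instead of its `.adm`).  U8d ED. 5 then hosts the socket
`sig_K2E1bModelOfRecordCohUnitary : ModelOfRecordCohUnitaryStmt` and re-pays 8b `sig_K2E1bUnitaryDualAtRegularChi` BY NAME from this glue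
(statement bytes of 8b unchanged); the 8b-α socket `sig_K2E1bModelOfRecord` stays typed and frozen, OPEN-ASIDE (off the live cone).

ROAD TO PAY 8b-αᵤ (census §3, all in-house): O4 joint torus weight spaces `V_{n,m}` of a `(𝔤,K)`-module of `U(2,1)` (twin of ★
`U11WeightDecomposition`); O5 `𝔨 ≅ 𝔤𝔩₂`-strings `u^k_{n,m}` (Mathlib `IsSl2Triple`) + multiplicity `≤ 1` transported from the ★ Gelfand-pair
theorem; O6 normal form of the `𝔭^±`-action (Kovacevic2021 §3 Thm. 1: `𝔭 ⊗ V_{n,m} → V_{n±1,m±3}`, Clebsch–Gordan for `U(2)`); O7–O8 the relations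
(b20)–(b45) = the fields of ★ `SU21Datum` and the gauge; O9 assembly of `𝒟` and the `GKEquiv` (★ `GKModulesKActionUnique`, ★ `kTypeRepTw`).

HONEST LABEL: HC_CM is proved only modulo the 7 printed citations (2 remaining named inputs: hLiu418 = stmt-HodgeConjecture-24832, h413 =
stmt-HodgeConjecture-24833) until rung 0 closes; this file closes nothing — it replaces one XL named input of socket 8b by a weaker L–XL one with a
fully in-house road.
-/

set_option autoImplicit false
set_option linter.dupNamespace false

noncomputable section

open Literature.NumberTheory.Automorphic
open Literature.RepresentationTheory
open Literature.RepresentationTheory.BorelWallach2000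
open Literature.RepresentationTheory.KonnoKonno2007 Literature.RepresentationTheory.KonnoKonno2007.RealDualPair
open Literature.RepresentationTheory.Kovacevic2021 Literature.RepresentationTheory.Kovacevic2021.SU21Datum
open Summit.HodgeConjecture.HodgeConjecture.Cruxes.H413.F0P3bLocalAPacketsDefs
open Summit.HodgeConjecture.HodgeConjecture.Cruxes.H413.F0P3bArchDegOnePackage (IsCohUnitaryIrrep)
open Summit.HodgeConjecture.HodgeConjecture.Cruxes.H413.K2E1bCarriersOfRecord
open Summit.HodgeConjecture.HodgeConjecture.Cruxes.H413.K2E1bDSCellData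
open Summit.HodgeConjecture.HodgeConjecture.Cruxes.H413.K2E1bDSClsOfRecord
open Summit.HodgeConjecture.HodgeConjecture.Cruxes.H413.K2E1bDSRecordRecognition

namespace Summit.HodgeConjecture.HodgeConjecture.Cruxes.H413.K2E1bGKCohomologyU21

-- Mathlib idiom (as in ★ `K2E1bUnitaryDualOfParts`): `Module.End ℂ V` ∕ matrices as Lie rings by commutators.
attribute [local instance 100] LieRing.ofAssociativeRing

namespace U8

/-! ## §1 The named input 8b-αᵤ (DEFS BEFORE SIGS — a `def` with body; PAID by a ★ theorem of exactly this type) -/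

/-- **8b-αᵤ «MODEL OF RECORD, COH-UNITARY CASE» (L–XL; abstract → datum for the modules the LEVEL-B′ pins actually produce)**: every coh-unitary
irreducible `(𝔤, K)`-module of `U(2,1)` (★ `IsCohUnitaryIrrep`: `(𝔤,K)`-module, irreducible, admissible, unitary along `𝔭 ⊕ ℝz₀`) with χ-scalars
`(κ, e)` is `(𝔤, K)`-equivalent to the structure of record (★ #23 `ρKOfRecord`, `σOfRecord`) of a Kovačević datum at the central weight `e`
(`K`-types of multiplicity `≤ 1` — ★ for unitary irreducibles of `U(2,1)` by Gelfand's trick; weight bases `u^k_{n,m}` adapted to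
`𝔭 ⊗ V_{n,m} → V_{n±1,m±3}`; the relations (b20)–(b45) hold in any such basis; integrality of `(n, m, e)` from the genuine `K`-action).
(print: Kovacevic2021, §3 Def. 1, Thm. 1–2; Kraljevic1973; BorelWallach2000, 0 §2.5) -/
def ModelOfRecordCohUnitaryStmt : Prop :=
  ∀ (r : GKIrrep G21) (κ e : ℤ), IsCohUnitaryIrrep r.ρK r.ρ𝔤 → HasChiScalars r.ρ𝔤 κ e →
    ∃ (𝒟 : SU21Datum) (hGK : IsGKModule G21 (ρKOfRecord 𝒟 e) (σOfRecord 𝒟 e))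
      (hirr : IsIrreducibleGK (ρKOfRecord 𝒟 e) (σOfRecord 𝒟 e)),
      GKIrrClass.mk r = GKIrrClass.mk ⟨𝒟.V, ρKOfRecord 𝒟 e, σOfRecord 𝒟 e, hGK, hirr⟩

/-- **8b-α ⇒ 8b-αᵤ**: the coh-unitary statement is the admissible one restricted along ★ `IsCohUnitaryIrrep.adm` — so 8b-αᵤ is WEAKER than 8b-α by a
kernel-checked arrow, and any payer of `ModelOfRecordStmt` pays `ModelOfRecordCohUnitaryStmt`. [cite: Kovacevic2021, §3 Thm. 1–2] [cite: BorelWallach2000, 0 §2.5] -/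
theorem modelOfRecordCohUnitary_of_modelOfRecord (h : ModelOfRecordStmt) : ModelOfRecordCohUnitaryStmt :=
  fun r κ e hcoh hchi => h r κ e hcoh.adm hchi

/-! ## §2 The glue: socket 8b from its parts, through 8b-αᵤ -/

/-- **SOCKET 8b FROM ITS PARTS, COH-UNITARY MODEL OF RECORD** (kernel-checked composition; the LEVEL-B′ assembly of `UnitaryDualWith`): for every
support predicate `P` implying the LEVEL-B′ pins, 8b-αᵤ ∕ 8b-α′ ∕ 8b-β ∕ 8b-δ and ★ 8b-γ `exists_mk_ofRecord_eq_cls` give `UnitaryDualWith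
dsCarriersOfRecord P`.  Same proof as ★ `unitaryDualWith_of_parts`, the representative's `IsCohUnitaryIrrep` being passed whole to 8b-αᵤ.
[cite: Rogawski1990, §12.3 pp. 176–178] [cite: Kovacevic2021, §3 Thm. 3; §4 Thm. 4] -/
theorem unitaryDualWith_of_parts_cohUnitary (P : ℤ → ℤ → ℤ → Fin 3 → GKIrrClass (uFormGroup (Fin 2) (Fin 1)) → Prop)
    (hP : ∀ (a b c : ℤ) (j : Fin 3) (x : GKIrrClass (uFormGroup (Fin 2) (Fin 1))), P a b c j x →
      IsChiPinnedCohUnitary x (casimirOf a b c) (centralOf a b c) ∧ SameCubicPin x (dsClsOfRecord a b c j))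
    (hα : ModelOfRecordCohUnitaryStmt) (hα' : RecordIrreducibleStmt) (hβ : DatumUnitaryDualStmt) (hδ : UnitarityDescendsStmt) :
    UnitaryDualWith dsCarriersOfRecord P := by
  intro a b c habc j x hx
  obtain ⟨⟨r, hrx, hcoh, hchi⟩, ⟨s, hxs, hjs⟩⟩ := hP a b c j x hx
  obtain ⟨𝒟, hGK, hirr, hmk⟩ := hα r (casimirOf a b c) (centralOf a b c) hcoh hchi
  have hdirr : LieModule.IsIrreducible ℂ (Matrix (Fin 3) (Fin 3) ℂ) 𝒟.V := hα' 𝒟 (centralOf a b c) hGK hirr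
  have hchi' : HasChiScalars (σOfRecord 𝒟 (centralOf a b c)) (casimirOf a b c) (centralOf a b c) := hchi.of_mk_eq_mk hmk
  have hunit : IsUnitarizable 𝒟 := hδ r 𝒟 (centralOf a b c) hGK hirr hcoh hmk
  have hpin : HasCubicPin (GKIrrClass.mk (⟨𝒟.V, ρKOfRecord 𝒟 (centralOf a b c), σOfRecord 𝒟 (centralOf a b c), hGK, hirr⟩ :
      GKIrrep G21)) s := by
    rw [← hmk, hrx]; exact hxs
  have hcub : HasCubicScalar (σOfRecord 𝒟 (centralOf a b c)) s := (hasCubicPin_mk_iff _ s).1 hpin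
  haveI := hdirr
  obtain ⟨i, hS, hPr, hQr⟩ := hβ a b c habc j 𝒟 hdirr hunit hchi' ⟨s, hcub, hjs⟩
  obtain ⟨i', hi'⟩ := exists_mk_ofRecord_eq_cls habc i forall_reach_of_isIrreducible hS hPr hQr hGK hirr
  exact ⟨i', by rw [← hrx, hmk]; exact hi'⟩

/-- Monotonicity for the dealer: the coh-unitary glue for `P` gives the glue for every STRONGER support predicate `Q ≤ P` (★ `UnitaryDualWith.anti`
pattern, as ★ `unitaryDualWith_of_parts_of_le`). [cite: Rogawski1990, §12.3 pp. 176–178] -/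
theorem unitaryDualWith_of_parts_cohUnitary_of_le (P Q : ℤ → ℤ → ℤ → Fin 3 → GKIrrClass (uFormGroup (Fin 2) (Fin 1)) → Prop)
    (hQP : ∀ a b c j x, Q a b c j x → P a b c j x)
    (hP : ∀ (a b c : ℤ) (j : Fin 3) (x : GKIrrClass (uFormGroup (Fin 2) (Fin 1))), P a b c j x →
      IsChiPinnedCohUnitary x (casimirOf a b c) (centralOf a b c) ∧ SameCubicPin x (dsClsOfRecord a b c j))
    (hα : ModelOfRecordCohUnitaryStmt) (hα' : RecordIrreducibleStmt) (hβ : DatumUnitaryDualStmt) (hδ : UnitarityDescendsStmt) :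
    UnitaryDualWith dsCarriersOfRecord Q :=
  fun a b c habc j x hx => unitaryDualWith_of_parts_cohUnitary P hP hα hα' hβ hδ a b c habc j x (hQP a b c j x hx)

end U8

end Summit.HodgeConjecture.HodgeConjecture.Cruxes.H413.K2E1bGKCohomologyU21

end
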